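import Summits.Ventures.QEC.Thresholds.ToricCodeDepolarizingKernelPT
import Summits.Ventures.QEC.Thresholds.ToricCodeThresholdKernelSymm
import HarnessLib

/-!
# Toric code, KERNEL constants in the `X` sector and under depolarizing noise from the symmetry-reduced memory-14 bound
# `μ(ℤ²) ≤ 2.7014`: `p_c^X > .0355`, `p_c^depol > .0532` (unconditional, tier CERTIFIED (kernel))

Venture QEC, `Summits/Ventures/QEC/Thresholds/` (LADDER-QEC rung Q5; continues `ToricCodeDepolarizingKernelPT.lean` of qec-type-09 with
qec-type-03's sharper kernel input). The transfer principle `toric_x_isThresholdLowerBound_of_z` (lattice duality,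
`ToricCodeXSectorThresholds.lean`) and the `3/2` rule (`DepolarizingThresholds.lean`) applied to the best KERNEL `Z`-sector constant,
`toricThreshold_kernelSymmK14 : IsThresholdLowerBound (toricFailureFamily D) (thresholdValue 2.7014)` (`ToricCodeThresholdKernelSymm.lean`;
input `SAW.Zd.connectiveConstant_two_le_27014`, the symmetry-reduced memory-14 Pönitz–Tittmann trie certificate checked by `decide` in
the kernel, `SAWFiniteMemoryKernelSymmK14.lean`):

* `toric_x_isThresholdLowerBound_kernelSymmK14` — `X`-sector (bit flips, plaquette syndrome) threshold `≥ p₀(2.7014)` for every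
  minimum-weight decoder family; decimal `toric_x_accuracyThreshold_gt_0355` (was `.0348`);
* `toric_depolarizing_isThresholdLowerBound_kernelSymmK14` — depolarizing threshold `≥ (3/2)·p₀(2.7014) ≈ .0533` for every pair of
  minimum-weight decoder families (sector-wise decoding); decimal `toric_depolarizing_accuracyThreshold_gt_0532` (was `.0522`);
  canonical instance `toric_depolarizing_isThresholdLowerBound_kernelSymmK14_minWeight`.

UNCONDITIONAL, kernel axioms, no named fact, no `native_decide`. HONEST FRAMING as in the packaged files: sector-wise (correlation-blind)
minimum-weight decoding; the `3/2` is the exact marginal conversion; these are certified LOWER bounds on the accuracy threshold;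
numerics are VALIDATED-column. Theorem-only file.

## References

* [DennisEtAl2002] E. Dennis, A. Kitaev, A. Landahl, J. Preskill, J. Math. Phys. 43 (2002) 4452, §3.1, §4.1, §5.3.
* [PonitzTittmann2000] A. Pönitz, P. Tittmann, Electron. J. Combin. 7 (2000) R21, §3 and Table 2 (`d = 2, k = 14`: `2.7014`).
-/

noncomputable section

namespace Summit.Ventures.QEC.Thresholds

open Filter Topology Finset Matrix
open Literature.InformationTheory.QuantumCodes
open Literature.InformationTheory.QuantumCodes.ToricCode

/-- **`X`-sector toric threshold `≥ p₀(2.7014)`** (kernel-checked symmetry-reduced memory-14 walk bound + lattice duality), every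
minimum-weight decoder family of the plaquette syndrome. UNCONDITIONAL. [cite: DennisEtAl2002, §5.3 eqs. (saw_2), (threshold_2d)] -/
theorem toric_x_isThresholdLowerBound_kernelSymmK14 (DX : (L : ℕ) → Decoder (Syndrome (L + 1)) (Chain (L + 1)))
    (hDX : ∀ L, (DX L).IsMinWeight (toricCode (L + 1)).xSyndrome
      ((toricCode (L + 1)).kerZ : Set (Chain (L + 1))) hammingNorm) :
    IsThresholdLowerBound (xFailureFamily (fun L => toricCode (L + 1)) DX) (thresholdValue 2.7014) :=
  toric_x_isThresholdLowerBound_of_z (fun _ hD => toricThreshold_kernelSymmK14 hD) DX hDX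

/-- **`p_c^X > .0355`** (decimal, kernel) for bit flips on the toric code, every minimum-weight decoder family.
[cite: DennisEtAl2002, §5.3 eq. (p_c_2d)] -/
theorem toric_x_accuracyThreshold_gt_0355 (DX : (L : ℕ) → Decoder (Syndrome (L + 1)) (Chain (L + 1)))
    (hDX : ∀ L, (DX L).IsMinWeight (toricCode (L + 1)).xSyndrome
      ((toricCode (L + 1)).kerZ : Set (Chain (L + 1))) hammingNorm) :
    (0.0355 : ℝ) < accuracyThreshold (xFailureFamily (fun L => toricCode (L + 1)) DX) :=
  lt_of_lt_of_le thresholdValue_27014_bounds.1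
    (le_accuracyThreshold (toric_x_isThresholdLowerBound_kernelSymmK14 DX hDX)
      ((thresholdValue_le_half _).trans (by norm_num)))

/-- **Depolarizing toric threshold `≥ (3/2)·p₀(2.7014) ≈ .0533`**, sector-wise minimum-weight decoding (any pair of
minimum-weight decoder families). UNCONDITIONAL, kernel. [cite: DennisEtAl2002, §4.1 (depolarizing channel vs. independent X/Z errors)] -/
theorem toric_depolarizing_isThresholdLowerBound_kernelSymmK14
    (DX : (L : ℕ) → Decoder (Syndrome (L + 1)) (Chain (L + 1))) (DZ : (L : ℕ) → ZDecoder (L + 1))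
    (hDX : ∀ L, (DX L).IsMinWeight (toricCode (L + 1)).xSyndrome
      ((toricCode (L + 1)).kerZ : Set (Chain (L + 1))) hammingNorm)
    (hDZ : ∀ L, (DZ L).IsMinWeight (syn (L + 1)) (cycles (L + 1)) hammingNorm) :
    IsThresholdLowerBound (depolarizingFailureFamily (fun L => toricCode (L + 1)) DX DZ)
      (3 / 2 * thresholdValue 2.7014) := by
  have hZ : IsThresholdLowerBound (zFailureFamily (fun L => toricCode (L + 1)) DZ) (thresholdValue 2.7014) := by
    rw [zFailureFamily_toricCode]
    exact toricThreshold_kernelSymmK14 hDZ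
  have h := depolarizing_isThresholdLowerBound (fun L => toricCode (L + 1)) DX DZ
    (toric_x_isThresholdLowerBound_kernelSymmK14 DX hDX) hZ ((min_le_left _ _).trans (thresholdValue_le_two_thirds _))
  rwa [min_self] at h

/-- **`p_c^depol > .0532`** (decimal, kernel) for the toric code under sector-wise minimum-weight decoding (was `.0522`).
[cite: DennisEtAl2002, §4.1 and §5.3] -/
theorem toric_depolarizing_accuracyThreshold_gt_0532
    (DX : (L : ℕ) → Decoder (Syndrome (L + 1)) (Chain (L + 1))) (DZ : (L : ℕ) → ZDecoder (L + 1))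
    (hDX : ∀ L, (DX L).IsMinWeight (toricCode (L + 1)).xSyndrome
      ((toricCode (L + 1)).kerZ : Set (Chain (L + 1))) hammingNorm)
    (hDZ : ∀ L, (DZ L).IsMinWeight (syn (L + 1)) (cycles (L + 1)) hammingNorm) :
    (0.0532 : ℝ) < accuracyThreshold (depolarizingFailureFamily (fun L => toricCode (L + 1)) DX DZ) := by
  have h := thresholdValue_27014_bounds.1
  refine lt_of_lt_of_le (by linarith)
    (le_accuracyThreshold (toric_depolarizing_isThresholdLowerBound_kernelSymmK14 DX DZ hDX hDZ) ?_)
  have := thresholdValue_le_half (2.7014 : ℝ)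
  linarith

/-- Canonical instance: minimum-weight decoding of both syndromes — depolarizing threshold `≥ (3/2)·p₀(2.7014)`.
UNCONDITIONAL, kernel. [cite: DennisEtAl2002, §4.1 and §5.1] -/
theorem toric_depolarizing_isThresholdLowerBound_kernelSymmK14_minWeight :
    IsThresholdLowerBound
      (depolarizingFailureFamily (fun L => toricCode (L + 1))
        (fun L => Decoder.minWeight (toricCode (L + 1)).xSyndrome hammingNorm)
        fun L => Decoder.minWeight (syn (L + 1)) hammingNorm)
      (3 / 2 * thresholdValue 2.7014) :=
  toric_depolarizing_isThresholdLowerBound_kernelSymmK14 _ _ toric_isMinWeight_minWeight_x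
    fun L => ToricCode.isMinWeight_minWeight (L + 1)

/-- Canonical decimal: `p_c^depol > .0532` for minimum-weight decoding of both syndromes — UNCONDITIONAL, kernel.
[cite: DennisEtAl2002, §4.1 and §5.3] -/
theorem ToricCode.depolarizing_accuracyThreshold_minWeight_gt_0532 :
    (0.0532 : ℝ) < accuracyThreshold
      (depolarizingFailureFamily (fun L => toricCode (L + 1))
        (fun L => Decoder.minWeight (toricCode (L + 1)).xSyndrome hammingNorm)
        fun L => Decoder.minWeight (syn (L + 1)) hammingNorm) :=
  toric_depolarizing_accuracyThreshold_gt_0532 _ _ toric_isMinWeight_minWeight_x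
    fun L => ToricCode.isMinWeight_minWeight (L + 1)

end Summit.Ventures.QEC.Thresholds
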